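import Literature.Analysis.FluidPDE.AxisymmetricTypeIPressureBounds
import Literature.Analysis.FluidPDE.SuitableWeakRescaling
import Literature.Analysis.FluidPDE.SereginSverakBlowupSelection
import Literature.Barriers.NavierStokesRegularity.AxisymmetricTypeIExclusion
import HarnessLib

/-!
# Axis points are regular under the Type I rate: the axis input of `axisymmetric_typeI_bounded`
# from the local theorem of Seregin–Šverák (barrier `AxisymmetricTypeIExclusion`)

Analysis/FluidPDE proofs-layer file (theorems only), third layer of the decomposition of
`Literature.Analysis.FluidPDE.knss_no_axisymmetric_typeI` (`Axisymmetric.lean`) through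
`axisymmetric_typeI_bounded` (`KNSSTypeII.lean`) and its local inputs
(`AxisymmetricTypeIBounded.lean`). It PROVES the axis input of the glue
`axisymmetric_typeI_bounded_of_local`, stated pointwise,

  `axisymmetric_typeI_boundedNearTop_axis_of_barrier :
     Literature.Barriers.NavierStokesRegularity.AxisymmetricTypeIExclusion →
       AxisymmetricTypeIHyp ν T u p → ∀ x₀, cylRadius x₀ = 0 → IsBoundedNearTop u T x₀`

(under the standing hypotheses of the target, every point of the axis is a point of local
boundedness at the final time), from the catalogued barrier fact (Seregin–Šverák, Comm. PDE 34
(2009), Thm. 3.1 = Thm. 1.1: an axially symmetric distributional solution `(v, q)` in the unit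
cylinder `Q = 𝒞 × ]-1, 0[`, `v ∈ L³(Q)`, `q ∈ L^{3/2}(Q)`, with `|v| ≤ C/√(-t)` a.e., is
essentially bounded on some backward parabolic cylinder about the vertex), read in the global
setting of the target as announced in `AxisymmetricTypeIBounded.lean`. The conclusion is the
unfolded axis hypothesis of `axisymmetric_typeI_bounded_of_local`; no intermediate named statement
stands between the barrier and the glue (D-0026: the global reading is not a printed result of its
own, so it is a theorem over the barrier, not a named fact).

## The argument

Let `H : AxisymmetricTypeIHyp ν T u p`, `x₀` on the axis, and `q` the gauged pressure of
`AxisymmetricTypeIGauge.lean` (`(u, q)` suitable, hence distributional, on every open region below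
`T`; `q(t) = p̃[u(t)]` for a.e. `t`). With `R > 0` small and the Navier–Stokes scaling normalising
the viscosity, `Φ(s, y) = (T + (R²/ν) s, x₀ + R y)`, `v = (R/ν) u ∘ Φ`, `π = (R/ν)² q ∘ Φ`
(`IsDistributionalNSSolutionOn.stRescale`, `SpaceTimeRescaling.lean`): the image `Φ(Q)` of the unit
cylinder is an open subset of a backward parabolic cylinder with top time `T`, inside the slab
`(0, T) × ℝ³`; `(v, π)` solves the unit-viscosity system in distributions on `Q`; `v ∈ L³(Q)` and
`π ∈ L^{3/2}(Q)` by the change of variables and the cylinder bounds of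
`AxisymmetricTypeIPressureBounds.lean`; `v(s, ·)` is axisymmetric because `x₀` is a fixed point of
the rotations about the axis, which are linear (`SereginSverak2009.rotZ_add_vec/_smul_vec`); and `√(-s) |v(s, y)| ≤ (R/ν) C / √(R²/ν)` from
the Type I rate. The barrier gives essential boundedness of `v` near the vertex, which transports
back (inverse affine map) to an a.e. bound for `u` on a backward neighbourhood of `(T, x₀)`, and an
a.e. bound is an everywhere bound for the continuous `u` on an open set.

## References

* G. Seregin, V. Šverák, *On Type I singularities of the local axi-symmetric solutions of the
  Navier–Stokes equations*, Comm. PDE 34 (2009) = arXiv:0804.1803, Thm. 3.1 (= Thm. 1.1), §3.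
  [SereginSverak2009]
* G. Koch, N. Nadirashvili, G. Seregin, V. Šverák, Acta Math. 203 (2009), Thm. 6.2 (setting).
  [KochNadirashviliSereginSverak2009]
-/

noncomputable section

open MeasureTheory Set Function Filter Topology TopologicalSpace Metric
open Literature.Barriers.NavierStokesRegularity
open scoped NNReal ENNReal

namespace Literature.Analysis.FluidPDE

/-- Local notation for physical space `ℝ³ = EuclideanSpace ℝ (Fin 3)`. -/
local notation "ℝ³" => EuclideanSpace ℝ (Fin 3)

/-! ### Rotations about the axis fix the axis (linearity: `SereginSverak2009.rotZ_add_vec`,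
`SereginSverak2009.rotZ_smul_vec`, `SereginSverakBlowupSelection.lean`) -/

/-- Points of the axis (`x 0 = x 1 = 0`, i.e. `cylRadius x = 0`) are fixed by every `R_θ`.
[folklore] -/
theorem rotZ_eq_self_of_cylRadius_eq_zero (θ : ℝ) {x : ℝ³} (hx : cylRadius x = 0) :
    rotZ θ x = x := by
  obtain ⟨h0, h1⟩ := (cylRadius_eq_zero_iff x).1 hx
  ext i
  fin_cases i <;> simp [rotZ, h0, h1]

/-- In the unit cylinder `𝒞 = {|y'| < 1, |y₃| < 1}` one has `‖y‖ < 2`. [folklore] -/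
theorem norm_lt_two_of_mem_ssCylinder {z : ℝ × ℝ³} (hz : z ∈ ssCylinder) : ‖z.2‖ < 2 := by
  obtain ⟨-, hr, h3⟩ := mem_ssCylinder.1 hz
  linarith [SereginSverak2009.norm_le_cylRadius_add_abs z.2]

/-! ### The affine image of the unit cylinder -/

section Image

variable {β γ T : ℝ} {x₀ : ℝ³}

/-- The physical image `Φ(Q)` of the Seregin–Šverák unit cylinder is open (`Φ` is a homeomorphism).
[folklore] -/
theorem isOpen_image_stAffine_ssCylinder (hβ : β ≠ 0) (hγ : γ ≠ 0) :
    IsOpen (stAffine β γ T x₀ '' ssCylinder) :=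
  (stAffineHomeomorph hβ hγ T x₀).isOpenMap _ isOpen_ssCylinder

/-- `Φ(Q)` lies in the backward parabolic cylinder `Q_ρ(T, x₀)` as soon as `β ≤ ρ²` and `2γ ≤ ρ`
(`Φ(s, y) = (T + βs, x₀ + γ y)`, `-1 < s < 0`, `‖y‖ < 2`). [folklore] -/
theorem image_stAffine_ssCylinder_subset (hβ : 0 < β) (hγ : 0 < γ) {ρ : ℝ} (h1 : β ≤ ρ ^ 2)
    (h2 : 2 * γ ≤ ρ) :
    stAffine β γ T x₀ '' ssCylinder ⊆ parabolicCylinder ρ ((T : ℝ), x₀) := by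
  rintro _ ⟨z, hz, rfl⟩
  obtain ⟨hs, -, -⟩ := mem_ssCylinder.1 hz
  have hy := norm_lt_two_of_mem_ssCylinder hz
  rw [mem_parabolicCylinder]
  refine ⟨⟨?_, ?_⟩, ?_⟩
  · show T - ρ ^ 2 < T + β * z.1
    nlinarith [hs.1]
  · show T + β * z.1 < T
    nlinarith [hs.2]
  · show dist (x₀ + γ • z.2) x₀ < ρ
    rw [dist_eq_norm, add_sub_cancel_left, norm_smul, Real.norm_of_nonneg hγ.le]
    nlinarith

/-- The preimage of `Φ(Q)` under `Φ` is `Q` (as `Opens`). [folklore] -/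
theorem stPreimage_image_ssCylinder (hβ : β ≠ 0) (hγ : γ ≠ 0)
    (hopen : IsOpen (stAffine β γ T x₀ '' ssCylinder)) :
    stPreimage β γ T x₀ (⟨stAffine β γ T x₀ '' ssCylinder, hopen⟩ : Opens (ℝ × ℝ³)) =
      ssCylinderOpens := by
  ext z
  change z ∈ stAffine β γ T x₀ ⁻¹' (stAffine β γ T x₀ '' ssCylinder) ↔ z ∈ ssCylinder
  rw [preimage_image_eq _ (injective_stAffine hβ hγ T x₀)]

end Image

/-! ### The axis input from the barrier -/

section Axis

/-- **Axis points are regular under the Type I rate** (the axis input of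
`axisymmetric_typeI_bounded_of_local`, `AxisymmetricTypeIBounded.lean`): under the standing
hypotheses `AxisymmetricTypeIHyp ν T u p` (classical solution on `ℝ³ × [0, T)`, Leray–Hopf,
bounded on sub-slabs, axisymmetric, Type I rate at `T`), `u` is bounded on a backward parabolic
neighbourhood of `(T, x₀)` for every `x₀` on the axis (`cylRadius x₀ = 0`). PROVED from the
catalogued barrier fact `AxisymmetricTypeIExclusion` (Seregin–Šverák 2009, Thm. 3.1 = Thm. 1.1),
along the argument of the module docstring (gauged pressure, viscosity-normalising parabolic
rescaling about the axis point, change of variables for the `L³`/`L^{3/2}` classes, axisymmetry of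
the rescaled field, the Type I rate in the rescaled time, and transport of the essential bound back
to an everywhere bound of the continuous `u`). The binders are strict-implicit, so that
`axisymmetric_typeI_boundedNearTop_axis_of_barrier hSS` is literally the axis hypothesis of the
glue. [cite: SereginSverak2009, Thm 3.1 (= Thm 1.1) and §3] -/
theorem axisymmetric_typeI_boundedNearTop_axis_of_barrier (hSS : AxisymmetricTypeIExclusion)
    ⦃ν T : ℝ⦄ ⦃u : ℝ → ℝ³ → ℝ³⦄ ⦃p : ℝ → ℝ³ → ℝ⦄ (H : AxisymmetricTypeIHyp ν T u p) (x₀ : ℝ³)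
    (hx₀ : cylRadius x₀ = 0) : IsBoundedNearTop u T x₀ := by
  have hν := H.viscosity_pos
  have hT := H.time_pos
  -- scales: `R > 0` with `ρ = R (2 + 1/√ν) = √T / 2`
  set κ : ℝ := 2 + (Real.sqrt ν)⁻¹ with hκ
  have hκpos : 0 < κ := by positivity
  set R : ℝ := Real.sqrt T / (2 * κ) with hR
  have hRpos : 0 < R := by positivity
  set ρ : ℝ := R * κ with hρ
  have hρT : ρ ^ 2 ≤ T := by
    have h1 : ρ = Real.sqrt T / 2 := by rw [hρ, hR]; field_simp
    rw [h1, div_pow, Real.sq_sqrt hT.le]; linarith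
  set α : ℝ := R / ν with hα
  set β : ℝ := R ^ 2 / ν with hβdef
  have hαpos : 0 < α := by positivity
  have hβpos : 0 < β := by positivity
  have hβeq : β = α * R := by rw [hβdef, hα]; field_simp
  have hsqβ : Real.sqrt β = R / Real.sqrt ν := by
    rw [hβdef, Real.sqrt_div' _ hν.le, Real.sqrt_sq hRpos.le]
  have hβρ : β ≤ ρ ^ 2 := by
    -- `β = (R/√ν)² ≤ (R κ)²` since `1/√ν ≤ κ`
    have h1 : β = (R * (Real.sqrt ν)⁻¹) ^ 2 := by
      rw [hβdef, mul_pow, inv_pow, Real.sq_sqrt hν.le, div_eq_mul_inv]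
    rw [h1, hρ]
    have h2 : (Real.sqrt ν)⁻¹ ≤ κ := by rw [hκ]; linarith
    have h3 : 0 ≤ (Real.sqrt ν)⁻¹ := by positivity
    exact pow_le_pow_left₀ (by positivity) (mul_le_mul_of_nonneg_left h2 hRpos.le) 2
  have h2Rρ : 2 * R ≤ ρ := by
    rw [hρ, hκ]
    have : 0 ≤ (Real.sqrt ν)⁻¹ := by positivity
    nlinarith
  -- the gauged pressure and the physical cylinder
  obtain ⟨q, hsuit, hqae, -⟩ := H.exists_gauged_pressure
  have hPopen := isOpen_image_stAffine_ssCylinder (T := T) (x₀ := x₀) hβpos.ne' hRpos.ne'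
  set PO : Opens (ℝ × ℝ³) := ⟨stAffine β R T x₀ '' ssCylinder, hPopen⟩ with hPO
  have hPcyl : (PO : Set (ℝ × ℝ³)) ⊆ parabolicCylinder ρ ((T : ℝ), x₀) :=
    image_stAffine_ssCylinder_subset hβpos hRpos hβρ h2Rρ
  have hcylslab : parabolicCylinder ρ ((T : ℝ), x₀) ⊆ Ioo 0 T ×ˢ (univ : Set ℝ³) := by
    intro z hz
    rw [mem_parabolicCylinder] at hz
    exact ⟨⟨by nlinarith [hz.1.1], hz.1.2⟩, mem_univ _⟩
  have hPslab : (PO : Set (ℝ × ℝ³)) ⊆ Ioo 0 T ×ˢ (univ : Set ℝ³) := hPcyl.trans hcylslab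
  -- the rescaled pair solves the unit-viscosity system in distributions on the unit cylinder
  have hdist : IsDistributionalNSSolutionOn ssCylinderOpens 1 0 (α • stPull β R T x₀ u)
      (α ^ 2 • stPull β R T x₀ q) := by
    have h0 := ((hsuit PO hPslab).distributional).stRescale hαpos hRpos hβeq T x₀
    have hvisc : α * ν / R = 1 := by
      rw [hα, div_mul_cancel₀ R hν.ne', div_self hRpos.ne']
    have hforce : ((α ^ 2 * R) • stPull β R T x₀ (0 : ℝ → ℝ³ → ℝ³)) = 0 := by
      funext s y; simp [stPull]
    rw [hvisc, hforce, stPreimage_image_ssCylinder hβpos.ne' hRpos.ne' hPopen] at h0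
    exact h0
  -- `v ∈ L³(Q)`
  have hpre : stAffine β R T x₀ ⁻¹' (PO : Set (ℝ × ℝ³)) = ssCylinder :=
    preimage_image_eq _ (injective_stAffine hβpos.ne' hRpos.ne' T x₀)
  have hL3 : ∫⁻ z in ssCylinder, ‖(α • stPull β R T x₀ u) z.1 z.2‖ₑ ^ (3 : ℕ) < ∞ := by
    rw [← hpre, setLIntegral_enorm_pow_stRescale hβpos hRpos T x₀ α u _ 3]
    refine ENNReal.mul_lt_top (ENNReal.mul_lt_top (ENNReal.pow_lt_top enorm_lt_top) ENNReal.ofReal_lt_top) ?_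
    exact lt_of_le_of_lt (lintegral_mono_set hPcyl) (H.lintegral_cylinder_enorm_pow_three_lt_top hρT x₀)
  -- `π ∈ L^{3/2}(Q)`
  have hL32 : ∫⁻ z in ssCylinder, ‖(α ^ 2 • stPull β R T x₀ q) z.1 z.2‖ₑ ^ (3 / 2 : ℝ) < ∞ := by
    rw [← hpre, setLIntegral_enorm_rpow_stRescale hβpos hRpos T x₀ (α ^ 2) q _ (by norm_num)]
    refine ENNReal.mul_lt_top (ENNReal.mul_lt_top
      (ENNReal.rpow_lt_top_of_nonneg (by norm_num) enorm_ne_top) ENNReal.ofReal_lt_top) ?_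
    exact lt_of_le_of_lt (lintegral_mono_set hPcyl)
      (H.lintegral_cylinder_gauged_pressure_lt_top hqae hρT x₀)
  -- axisymmetry of the rescaled slices (`x₀` is fixed by the rotations, which are linear)
  have haxi : ∀ s ∈ Ioo (-1 : ℝ) 0, IsAxisymmetric ((α • stPull β R T x₀ u) s) := by
    intro s hs θ y
    have hτ : T + β * s ∈ Ico 0 T := by
      constructor
      · have : β ≤ T := hβρ.trans hρT
        nlinarith [hs.1]
      · nlinarith [hs.2]
    simp only [smul_stPull_apply]
    rw [show x₀ + R • rotZ θ y = rotZ θ (x₀ + R • y) by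
      rw [SereginSverak2009.rotZ_add_vec, SereginSverak2009.rotZ_smul_vec,
        rotZ_eq_self_of_cylRadius_eq_zero θ hx₀],
      H.axisymmetric _ hτ θ, SereginSverak2009.rotZ_smul_vec]
  -- the Type I rate in the rescaled time
  obtain ⟨C, -, hC⟩ := H.exists_typeI_rate
  have htypeI : ∃ C' : ℝ, ∀ᵐ z ∂(volume.restrict ssCylinder),
      Real.sqrt (-z.1) * ‖(α • stPull β R T x₀ u) z.1 z.2‖ ≤ C' := by
    refine ⟨α / Real.sqrt β * C, (ae_restrict_mem isOpen_ssCylinder.measurableSet).mono ?_⟩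
    intro z hz
    obtain ⟨hs, -, -⟩ := mem_ssCylinder.1 hz
    have hτ : T + β * z.1 ∈ Ico 0 T := by
      constructor
      · have : β ≤ T := hβρ.trans hρT
        nlinarith [hs.1]
      · nlinarith [hs.2]
    have hrate := hC _ hτ (x₀ + R • z.2)
    have hsq : Real.sqrt (T - (T + β * z.1)) = Real.sqrt β * Real.sqrt (-z.1) := by
      rw [show T - (T + β * z.1) = β * (-z.1) by ring, Real.sqrt_mul hβpos.le]
    rw [hsq] at hrate
    have hsβ : 0 < Real.sqrt β := Real.sqrt_pos.2 hβpos
    rw [smul_stPull_apply, norm_smul, Real.norm_of_nonneg hαpos.le]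
    calc Real.sqrt (-z.1) * (α * ‖u (T + β * z.1) (x₀ + R • z.2)‖)
        = α / Real.sqrt β * (Real.sqrt β * Real.sqrt (-z.1) * ‖u (T + β * z.1) (x₀ + R • z.2)‖) := by
          field_simp
      _ ≤ α / Real.sqrt β * C :=
          mul_le_mul_of_nonneg_left hrate (by positivity)
  -- the barrier: essential boundedness near the vertex
  obtain ⟨r, hr, hbd⟩ := hSS _ _ hdist hL3 hL32 haxi htypeI
  -- an a.e. bound for `u ∘ Φ` on `Q_r(0)`
  set S' : Set (ℝ × ℝ³) := parabolicCylinder r ((0 : ℝ), (0 : ℝ³)) with hS'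
  set M : ℝ := (eLpNorm (uncurry (α • stPull β R T x₀ u)) ∞ (volume.restrict S')).toReal with hM
  have haeS' : ∀ᵐ w ∂(volume.restrict S'), ‖u (stAffine β R T x₀ w).1 (stAffine β R T x₀ w).2‖ ≤ M / α := by
    have h1 := ae_le_eLpNormEssSup (μ := volume.restrict S') (f := uncurry (α • stPull β R T x₀ u))
    filter_upwards [h1] with w hw
    rw [← eLpNorm_exponent_top] at hw
    have hw' : ‖uncurry (α • stPull β R T x₀ u) w‖ ≤ M := by
      rw [hM, ← ENNReal.ofReal_le_iff_le_toReal hbd.ne, ofReal_norm]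
      exact hw
    rw [le_div_iff₀' hαpos]
    have e : uncurry (α • stPull β R T x₀ u) w =
        α • u (stAffine β R T x₀ w).1 (stAffine β R T x₀ w).2 := by
      obtain ⟨s, y⟩ := w; rfl
    rw [e, norm_smul, Real.norm_of_nonneg hαpos.le] at hw'
    exact hw'
  -- transported to the image `Φ(Q_r(0))`
  have haeP : ∀ᵐ z ∂((volume : Measure (ℝ × ℝ³)).restrict (stAffine β R T x₀ '' S')),
      ‖u z.1 z.2‖ ≤ M / α := by
    refine ae_restrict_of_ae_restrict_preimage_stAffine hβpos hRpos T x₀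
      (P := fun z : ℝ × ℝ³ => ‖u z.1 z.2‖ ≤ M / α) ?_
    rw [preimage_image_eq _ (injective_stAffine hβpos.ne' hRpos.ne' T x₀)]
    exact haeS'
  -- a backward neighbourhood of `(T, x₀)` inside `Φ(Q_r(0))` and inside the slab
  set r' : ℝ := min (r * min (Real.sqrt β) R) (Real.sqrt T / 2) with hr'
  have hmin : 0 < min (Real.sqrt β) R := lt_min (Real.sqrt_pos.2 hβpos) hRpos
  have hr'pos : 0 < r' := lt_min (mul_pos hr hmin) (by positivity)
  have hr'le : r' ≤ r * min (Real.sqrt β) R := min_le_left _ _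
  have hr'T : r' ^ 2 ≤ T / 4 := by
    have h1 : r' ≤ Real.sqrt T / 2 := min_le_right _ _
    have h2 : r' ^ 2 ≤ (Real.sqrt T / 2) ^ 2 := pow_le_pow_left₀ hr'pos.le h1 2
    rw [div_pow, Real.sq_sqrt hT.le] at h2
    linarith
  set U : Set (ℝ × ℝ³) := Ioo (T - r' ^ 2) T ×ˢ ball x₀ r' with hU
  have hUsub : U ⊆ stAffine β R T x₀ '' S' := by
    rintro ⟨t, x⟩ ⟨ht, hx⟩
    refine ⟨((t - T) / β, R⁻¹ • (x - x₀)), ?_, ?_⟩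
    · rw [hS', mem_parabolicCylinder]
      have hr'β : r' ^ 2 ≤ β * r ^ 2 := by
        have h1 : r' ≤ r * Real.sqrt β :=
          hr'le.trans (mul_le_mul_of_nonneg_left (min_le_left _ _) hr.le)
        have h2 : r' ^ 2 ≤ (r * Real.sqrt β) ^ 2 := pow_le_pow_left₀ hr'pos.le h1 2
        rw [mul_pow, Real.sq_sqrt hβpos.le] at h2
        linarith
      have hr'R : r' ≤ R * r := by
        have h1 : r' ≤ r * R := hr'le.trans (mul_le_mul_of_nonneg_left (min_le_right _ _) hr.le)
        linarith
      refine ⟨⟨?_, ?_⟩, ?_⟩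
      · show (0 : ℝ) - r ^ 2 < (t - T) / β
        rw [lt_div_iff₀ hβpos]; nlinarith [ht.1]
      · show (t - T) / β < 0
        exact div_neg_of_neg_of_pos (by linarith [ht.2]) hβpos
      · show dist (R⁻¹ • (x - x₀)) 0 < r
        rw [dist_zero_right, norm_smul, Real.norm_of_nonneg (inv_nonneg.2 hRpos.le),
          inv_mul_lt_iff₀ hRpos]
        rw [mem_ball, dist_eq_norm] at hx
        linarith
    · rw [stAffine_apply]
      ext1
      · show T + β * ((t - T) / β) = t
        field_simp; ring
      · show x₀ + R • R⁻¹ • (x - x₀) = x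
        rw [smul_smul, mul_inv_cancel₀ hRpos.ne', one_smul, add_sub_cancel]
  -- everywhere bound on `U` by continuity
  have hUopen : IsOpen U := isOpen_Ioo.prod isOpen_ball
  have hUslab : U ⊆ Ioo 0 T ×ˢ (univ : Set ℝ³) := by
    rintro ⟨t, x⟩ ⟨ht, -⟩
    exact ⟨⟨by nlinarith [ht.1], ht.2⟩, mem_univ _⟩
  have hcont : ContinuousOn (fun z : ℝ × ℝ³ => u z.1 z.2) U :=
    H.classical_Ioo.smooth_velocity.continuousOn.mono hUslab
  have hbound := SereginSverak2009.forall_le_of_ae_le_of_continuousOn hUopen hcont.norm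
    continuousOn_const (ae_restrict_of_ae_restrict_of_subset hUsub haeP)
  exact ⟨r', hr'pos, M / α, fun t ht x hx => hbound (t, x) ⟨ht, hx⟩⟩

end Axis

end Literature.Analysis.FluidPDE

end
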